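import Mathlib
import Literature.Analysis.FluidPDE.ElgindiSelfSimilarEquations
import HarnessLib
/-!
# The axis balance of the class-E profile equation for a GENERAL stream function: the full Biot–Savart law enters only through the
# axial strain, with coefficient `1 − 2α` on its value and `α(1 − 2α/3)` on its `z`-derivative — so at `α → 1/2` only the derivative survives

HONEST FRAMING (cell ns-blowup GROUP B «PROFILE SEARCH», zone Z6 «Elgindi-type C^{1,α} no-swirl self-similar blow-up»; human
rulings D-0035/D-0074/D-0081): calculus and real algebra about the ν = 0 axisymmetric NO-SWIRL **EULER** profile system of
`Literature.Analysis.FluidPDE.Elgindi` (`opU`, `opR`) in Elgindi's `(z, θ)` gauge, for stream functions written as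
`Φ(z, θ) = cos θ · Ψ(z, θ)` (every `Φ` vanishing to first order on the axis `θ = π/2`, as the Dirichlet condition of
`Elgindi.IsStreamFunction` requires, has this form). «violates: none — MODEL (Euler)»; nothing about Navier–Stokes and nothing about
existence of profiles. Companion of `ElgindiStrainModeCoefficients` (the special case `Ψ = 2ℓ(z) sin θ`, i.e. `Φ = ℓ sin 2θ`),
`ElgindiDrainClosure`, `ElgindiTrenchDeficit` (profile-eng-10) and `ElgindiDrainMatching` (profile-eng-9); pen side:
HOME/profile/z6twin/asym/g6/AXIS-BALANCE.md (eng-10 g6).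

WHY. In the transport form `a H_s + U H_θ = c H` of the class-E equation (`F = Γ_E z H`, `a = (1+δ) + αV`, `c = 𝓡 − 1 − a − UΓ_E′/Γ_E`)
the amplitude law on the AXIS is governed by `(c + a)|_{θ=π/2} = (𝓡 − 1 − UΓ_E′/Γ_E)|_{θ=π/2}`; the drain closure of the ℓ-REDUCED
model (`C₀ = 2/3`, `m_char → 1/3`) used this with `Φ` TRUNCATED to the strain mode `ℓ sin 2θ`. KERNEL-CHECKED HERE, for the FULL `Φ`:
* `opU_cosMul`, `opR_cosMul`, `dθ_cosMul`: `U(cos θ·Ψ) = −cos θ(3Ψ + αzΨ_z)`, `𝓡(cos θ·Ψ) = sin θ Ψ + α sin θ zΨ_z + cos θ Ψ_θ`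
  (`cos θ ≠ 0`) — in this representation `𝓡` has NO `1/cos θ` singularity;
* `axisBalance_cosMul`: on the open strip, `𝓡 − 1 − U·(Γ_E′/Γ_E)` (`Γ_E′/Γ_E = (α/3)cot θ − (2α/3)tan θ`) EQUALS
  `E(θ) := −1 + cos θ Ψ_θ + sin θ[(1 − 2α)Ψ + α(1 − 2α/3) zΨ_z] + (α/3)(cos²θ/sin θ)(3Ψ + αzΨ_z)`;
* `axisBalance_tendsto`: if the slices `Ψ`, `Ψ_θ`, `zΨ_z` have limits `Ψᵃ, Ψ_θᵃ, (zΨ_z)ᵃ` at `θ → π/2⁻`, then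
  `E(θ) → −1 + (1 − 2α)Ψᵃ + α(1 − 2α/3)(zΨ_z)ᵃ` — **the axis balance sees the stream function only through the axial strain
  `Ψᵃ(z) = −∂_θΦ(z, π/2)` and its `z`-derivative, with coefficients `1 − 2α` and `α(1 − 2α/3)`**;
* `axisBalance_half`: at `α = 1/2` the coefficient of `Ψᵃ` VANISHES and that of `(zΨ_z)ᵃ` is `1/3`: axis balance `= −1 + (zΨ_z)ᵃ/3`;
* `axisBalance_strainMode`: for `Ψ = 2ℓ sin θ` this is `(2 − 4α)ℓ − 1 + α(2 − 4α/3)zℓ′` = the `x = 1` value of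
  `transportCoeff_c_strainMode + transportCoeff_a_strainMode` (consistency with the reduced model);
* `axisBalance_normalForm` / `axisBalance_local_secondOrder`: writing `Ψᵃ = 2((1+δ)λ + P₁)`, `(zΨ_z)ᵃ = 2((1+δ)λ′ + Q₁)` (strain-mode
  part + the rest) and dividing by `1+δ = 1/ε`: axis balance `= [−ε + 2(1−2α)λ + α(2−4α/3)λ′] + ε[2(1−2α)P₁ + α(2−4α/3)Q₁]`, and with
  `α = 1/2 − Cε` the `P₁`-term is `4Cε²P₁`. READING (pen, AXIS-BALANCE.md): the non-strain part of `Φ` is LOCAL in `z` (angular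
  overtones `λ_n = 2n(2n+5) ≥ 14`, radial kernels `(z/z′)^{4n}`, `(z′/z)^{4n+10}`) hence `P₁ = O(local amplitude) = O(1)` and on the
  draining plateau `Q₁ = zP₁′ = O(εP₁)`, so BOTH corrections are `O(ε²)` against the `O(ε)` terms that fix the drain orbit ⇒ the
  full class-E model has the SAME leading-order orbit, `C₀(full) = 2/3` and `m_char → 1/3` (closure-level; the trench constant `J_∞`,
  hence `κ₁`, IS renormalised by `Q₁` in regime II).
WHAT IS NOT PROVED: the locality/size statements about `P₁`, `Q₁` (elliptic estimates + the quasi-steady plateau, pen only), the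
closure itself, anything about existence of profiles. PLACEMENT: cell-own MODEL/Euler-gauge lemma (profile-eng-10); bears on LADDER-NS
N5 / zone Z6 case Z6-1 (c) «death mechanism» P-Z6-6 (conjecture «C₀(full class E) = 2/3» of eng-10 g5) → N1 linear core.
-/

open Real Filter Topology

namespace Summit.NavierStokesRegularity.OSWSelfSimilar
namespace ElgindiAxisBalance

open Literature.Analysis.FluidPDE

/-! ### Slice derivatives and the operators on `Φ = cos θ · Ψ` -/

/-- `∂_z(cos θ·Ψ) = cos θ·Ψ_z`. [folklore] -/
theorem dz_cosMul {Ψ : ℝ → ℝ → ℝ} {Ψz z : ℝ} (θ : ℝ) (hz : HasDerivAt (fun z' => Ψ z' θ) Ψz z) :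
    Elgindi.dz (fun z θ => Real.cos θ * Ψ z θ) z θ = Real.cos θ * Ψz := by
  unfold Elgindi.dz
  exact (hz.const_mul _).deriv

/-- `∂_θ(cos θ·Ψ) = −sin θ·Ψ + cos θ·Ψ_θ`. [folklore] -/
theorem dθ_cosMul {Ψ : ℝ → ℝ → ℝ} {Ψθ θ : ℝ} (z : ℝ) (hθ : HasDerivAt (fun θ' => Ψ z θ') Ψθ θ) :
    Elgindi.dθ (fun z θ => Real.cos θ * Ψ z θ) z θ = -Real.sin θ * Ψ z θ + Real.cos θ * Ψθ := by
  unfold Elgindi.dθ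
  exact ((Real.hasDerivAt_cos θ).mul hθ).deriv

/-- **`U(cos θ·Ψ) = −cos θ(3Ψ + αzΨ_z)`** (`U(Φ) = −3Φ − αz∂_zΦ`). [new here — MODEL/Euler gauge calculus; AXIS-BALANCE.md §1] -/
theorem opU_cosMul (α : ℝ) {Ψ : ℝ → ℝ → ℝ} {Ψz z : ℝ} (θ : ℝ) (hz : HasDerivAt (fun z' => Ψ z' θ) Ψz z) :
    Elgindi.opU α (fun z θ => Real.cos θ * Ψ z θ) z θ = -Real.cos θ * (3 * Ψ z θ + α * (z * Ψz)) := by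
  rw [Elgindi.opU, Elgindi.Dz_eq_mul_dz, dz_cosMul θ hz]
  ring

/-- **`𝓡(cos θ·Ψ) = sin θ Ψ + α sin θ zΨ_z + cos θ Ψ_θ`** (`cos θ ≠ 0`): in the `cos θ·Ψ` representation the stretching rate has no
`1/cos θ` and extends continuously to the axis with value `Ψᵃ + α(zΨ_z)ᵃ`. [new here — MODEL/Euler gauge calculus; AXIS-BALANCE.md §1] -/
theorem opR_cosMul (α : ℝ) {Ψ : ℝ → ℝ → ℝ} {Ψz Ψθ z θ : ℝ} (hz : HasDerivAt (fun z' => Ψ z' θ) Ψz z)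
    (hθ : HasDerivAt (fun θ' => Ψ z θ') Ψθ θ) (hc : Real.cos θ ≠ 0) :
    Elgindi.opR α (fun z θ => Real.cos θ * Ψ z θ) z θ
      = Real.sin θ * Ψ z θ + α * Real.sin θ * (z * Ψz) + Real.cos θ * Ψθ := by
  rw [Elgindi.opR, Elgindi.Dz_eq_mul_dz, dz_cosMul θ hz, dθ_cosMul z hθ, div_eq_iff hc]
  ring

/-! ### The axis balance `𝓡 − 1 − U·Γ_E′/Γ_E` -/

/-- **The axis balance on the open strip.** With `Γ_E′/Γ_E = (α/3)(cos θ/sin θ) − (2α/3)(sin θ/cos θ)` (class-E weight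
`(sin θ cos²θ)^{α/3}`, `ElgindiStrainMode.weightLogDeriv_E_mul_sin_two`) and `Φ = cos θ·Ψ` (`sin θ ≠ 0`, `cos θ ≠ 0`):
`𝓡(Φ) − 1 − U(Φ)·Γ_E′/Γ_E = −1 + cos θ Ψ_θ + sin θ[(1−2α)Ψ + α(1−2α/3)zΨ_z] + (α/3)(cos²θ/sin θ)(3Ψ + αzΨ_z)`. This is `c + a`
of the transport form `aH_s + UH_θ = cH` of the class-E profile equation. [new here — MODEL/Euler gauge calculus; AXIS-BALANCE.md §1] -/
theorem axisBalance_cosMul (α : ℝ) {Ψ : ℝ → ℝ → ℝ} {Ψz Ψθ z θ : ℝ} (hz : HasDerivAt (fun z' => Ψ z' θ) Ψz z)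
    (hθ : HasDerivAt (fun θ' => Ψ z θ') Ψθ θ) (hs : Real.sin θ ≠ 0) (hc : Real.cos θ ≠ 0) :
    Elgindi.opR α (fun z θ => Real.cos θ * Ψ z θ) z θ - 1
        - Elgindi.opU α (fun z θ => Real.cos θ * Ψ z θ) z θ
          * (α / 3 * (Real.cos θ / Real.sin θ) - 2 * α / 3 * (Real.sin θ / Real.cos θ))
      = -1 + Real.cos θ * Ψθ + Real.sin θ * ((1 - 2 * α) * Ψ z θ + α * (1 - 2 * α / 3) * (z * Ψz))
        + α / 3 * (Real.cos θ ^ 2 / Real.sin θ) * (3 * Ψ z θ + α * (z * Ψz)) := by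
  rw [opR_cosMul α hz hθ hc, opU_cosMul α θ hz]
  field_simp
  ring

/-- **The axis value.** If along `θ → π/2⁻` (at fixed `z`) the slice value, the `θ`-derivative and `z·`(the `z`-derivative) of `Ψ`
tend to `Ψᵃ, Ψθᵃ, Mᵃ`, then the right-hand side of `axisBalance_cosMul` tends to `−1 + (1 − 2α)Ψᵃ + α(1 − 2α/3)Mᵃ`: the `cos θ Ψ_θ`
and `cos²θ/sin θ` terms drop out. So THE AXIS BALANCE OF THE FULL MODEL DEPENDS ON `Φ` ONLY THROUGH THE AXIAL STRAIN `Ψᵃ = −∂_θΦ|_{π/2}`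
AND ITS `z`-DERIVATIVE. [new here — MODEL real analysis; AXIS-BALANCE.md §1] -/
theorem axisBalance_tendsto (α : ℝ) {A B M : ℝ → ℝ} {Aa Ba Ma : ℝ}
    (hA : Tendsto A (𝓝[<] (π / 2)) (𝓝 Aa)) (hB : Tendsto B (𝓝[<] (π / 2)) (𝓝 Ba))
    (hM : Tendsto M (𝓝[<] (π / 2)) (𝓝 Ma)) :
    Tendsto (fun θ => -1 + Real.cos θ * B θ + Real.sin θ * ((1 - 2 * α) * A θ + α * (1 - 2 * α / 3) * M θ)
        + α / 3 * (Real.cos θ ^ 2 / Real.sin θ) * (3 * A θ + α * M θ)) (𝓝[<] (π / 2))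
      (𝓝 (-1 + (1 - 2 * α) * Aa + α * (1 - 2 * α / 3) * Ma)) := by
  have hcos : Tendsto Real.cos (𝓝[<] (π / 2)) (𝓝 0) := by
    have h := Real.continuous_cos.tendsto (π / 2)
    rw [Real.cos_pi_div_two] at h
    exact tendsto_nhdsWithin_of_tendsto_nhds h
  have hsin : Tendsto Real.sin (𝓝[<] (π / 2)) (𝓝 1) := by
    have h := Real.continuous_sin.tendsto (π / 2)
    rw [Real.sin_pi_div_two] at h
    exact tendsto_nhdsWithin_of_tendsto_nhds h
  have h1 : Tendsto (fun θ => Real.cos θ * B θ) (𝓝[<] (π / 2)) (𝓝 (0 * Ba)) := hcos.mul hB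
  have h2 : Tendsto (fun θ => Real.sin θ * ((1 - 2 * α) * A θ + α * (1 - 2 * α / 3) * M θ)) (𝓝[<] (π / 2))
      (𝓝 (1 * ((1 - 2 * α) * Aa + α * (1 - 2 * α / 3) * Ma))) :=
    hsin.mul ((hA.const_mul _).add (hM.const_mul _))
  have h3 : Tendsto (fun θ => α / 3 * (Real.cos θ ^ 2 / Real.sin θ) * (3 * A θ + α * M θ)) (𝓝[<] (π / 2))
      (𝓝 (α / 3 * (0 ^ 2 / 1) * (3 * Aa + α * Ma))) :=
    (((hcos.pow 2).div hsin one_ne_zero).const_mul _).mul ((hA.const_mul _).add (hM.const_mul _))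
  have h := ((tendsto_const_nhds (x := (-1 : ℝ))).add h1).add h2 |>.add h3
  have hval : (-1 : ℝ) + 0 * Ba + 1 * ((1 - 2 * α) * Aa + α * (1 - 2 * α / 3) * Ma) + α / 3 * (0 ^ 2 / 1) * (3 * Aa + α * Ma)
      = -1 + (1 - 2 * α) * Aa + α * (1 - 2 * α / 3) * Ma := by ring
  rw [hval] at h
  exact h

/-- **At `α = 1/2` the undifferentiated axial strain DROPS OUT**: the coefficients are `1 − 2α = 0` and `α(1 − 2α/3) = 1/3`, so the
axis balance is `−1 + Mᵃ/3` with `Mᵃ = z∂_z(−∂_θΦ)|_{π/2}` — only the `z`-DERIVATIVE of the axial strain matters. This is the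
structural reason the local (non-`L₁₂`) part of the Biot–Savart law is invisible at leading order on the draining plateau, where
everything varies on the slow scale `1/ε` in `s = ln z`. [new here — MODEL algebra; AXIS-BALANCE.md §2] -/
theorem axisBalance_half (Aa Ma : ℝ) :
    (1 - 2 * (1 / 2 : ℝ)) = 0 ∧ (1 / 2 : ℝ) * (1 - 2 * (1 / 2) / 3) = 1 / 3
      ∧ -1 + (1 - 2 * (1 / 2 : ℝ)) * Aa + (1 / 2 : ℝ) * (1 - 2 * (1 / 2) / 3) * Ma = -1 + Ma / 3 := by
  refine ⟨by norm_num, by norm_num, by ring⟩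

/-- **Consistency with the strain mode.** For `Ψ = 2ℓ(z) sin θ` (`Φ = cos θ·Ψ = ℓ sin 2θ`) the axis data are `Ψᵃ = 2ℓ`,
`Mᵃ = 2zℓ′`, and the axis balance `−1 + (1−2α)·2ℓ + α(1−2α/3)·2m` (`m = zℓ′`) equals the `x = sin²θ = 1` value of
`transportCoeff_c_strainMode + transportCoeff_a_strainMode` of `ElgindiStrainModeCoefficients`, i.e.
`[(2ℓ − 2 − δ) + αm(2·1 + (2α/3)(1 − 3·1))] + [(1+δ) + 2αℓ(1 − 3·1)]`. [new here — MODEL algebra; AXIS-BALANCE.md §1] -/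
theorem axisBalance_strainMode (α δ ℓ m : ℝ) :
    -1 + (1 - 2 * α) * (2 * ℓ) + α * (1 - 2 * α / 3) * (2 * m)
      = ((2 * ℓ - 2 - δ) + α * m * (2 * 1 + 2 * α / 3 * (1 - 3 * 1))) + ((1 + δ) + 2 * α * ℓ * (1 - 3 * 1)) := by
  ring

/-- `cos θ · (2ℓ sin θ) = ℓ sin 2θ`: the strain mode in the `cos θ·Ψ` representation. [folklore] -/
theorem cosMul_strainMode (ℓ θ : ℝ) : Real.cos θ * (2 * ℓ * Real.sin θ) = ℓ * Real.sin (2 * θ) := by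
  rw [Real.sin_two_mul]; ring

/-! ### Normal form: the non-strain part of `Φ` enters at one order higher in `ε = 1/(1+δ)` -/

/-- **Normal form of the axis balance.** Split the axis data into the strain-mode part and the rest, `Ψᵃ = 2((1+δ)λ + P₁)`,
`Mᵃ = 2((1+δ)λ′ + Q₁)` (`λ = ℓ/(1+δ)`, `λ′ = zℓ′/(1+δ) = −g/(4α)`; `P₁ = −½∂_θΦ₁|_{π/2}`, `Q₁ = zP₁′` for `Φ₁ = Φ − ℓ sin 2θ`), and
divide by `1 + δ = 1/ε`: the axis balance is the REDUCED one, `−ε + 2(1−2α)λ + α(2−4α/3)λ′`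
(`ElgindiStrainModeCoefficients.transportCoeff_normalForm` at `x = 1`), PLUS `ε·[2(1−2α)P₁ + α(2−4α/3)Q₁]`.
[new here — MODEL algebra; AXIS-BALANCE.md §2] -/
theorem axisBalance_normalForm (α δ lam lam' P₁ Q₁ : ℝ) (hδ : 1 + δ ≠ 0) :
    (1 / (1 + δ)) * (-1 + (1 - 2 * α) * (2 * ((1 + δ) * lam + P₁)) + α * (1 - 2 * α / 3) * (2 * ((1 + δ) * lam' + Q₁)))
      = (-(1 / (1 + δ)) + 2 * (1 - 2 * α) * lam + α * (2 - 4 * α / 3) * lam')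
        + (1 / (1 + δ)) * (2 * (1 - 2 * α) * P₁ + α * (2 - 4 * α / 3) * Q₁) := by
  field_simp
  ring

/-- **The local part is second order on the plateau.** With `α = 1/2 − Cε` (`C = (1+δ)(1/2 − α)`): the `P₁`-term of
`axisBalance_normalForm` is `ε·2(1−2α)P₁ = 4Cε²P₁` and the `Q₁`-coefficient is `ε·α(2−4α/3) = ε(2/3 − (2C/3)ε − (4C²/3)ε²)`. Since on
the draining plateau `Q₁ = zP₁′ = O(εP₁)` (slow scale) and `P₁ = O(1)` (local elliptic response to an `O(1)` local vorticity amplitude,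
pen), both corrections are `O(ε²)` while the terms fixing the drain orbit (`−ε + 2(1−2α)λ − g/3 = ε(μ − 4CΛ) − g/3`, `g = O(ε)`) are
`O(ε)`: the full class-E model has the reduced model's leading-order drain orbit, `C₀(full) = 2/3`, `m_char → 1/3` (closure-level).
[new here — MODEL algebra; AXIS-BALANCE.md §2] -/
theorem axisBalance_local_secondOrder (C ε P₁ : ℝ) :
    ε * (2 * (1 - 2 * (1 / 2 - C * ε))) * P₁ = 4 * C * ε ^ 2 * P₁
      ∧ ε * ((1 / 2 - C * ε) * (2 - 4 * (1 / 2 - C * ε) / 3)) = ε * (2 / 3 - 2 * C / 3 * ε - 4 * C ^ 2 / 3 * ε ^ 2) := by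
  constructor <;> ring

/-- **The reduced axis balance in drain variables** (bookkeeping, `α = 1/2 − Cε`, `λ = λ₀ − Λ`, `λ₀ = (1+ε)/2`, `λ′ = −g/(4α)`):
`−ε + 2(1−2α)λ + α(2−4α/3)λ′ = ε(2C − 1 − 4CΛ + 2Cε) − g·(1/2 − α/3)·... `; precisely
`−ε + 2(1−2α)(λ₀ − Λ) − (2−4α/3)g/4 = ε·((2C − 1) − 4CΛ + 2Cε) − (1/2 − α/3)·g` — the `O(ε)` balance `ε(μ − 4CΛ) − g/3 + O(ε²)` of
`ElgindiDrainClosure` (`μ = 2C − 1`, local-flux coefficient `1/2 − α/3 → 1/3`). [new here — MODEL algebra] -/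
theorem axisBalance_reduced_drainVariables (C ε Λ g : ℝ) :
    -ε + 2 * (1 - 2 * (1 / 2 - C * ε)) * ((1 + ε) / 2 - Λ) - (2 - 4 * (1 / 2 - C * ε) / 3) * g / 4
      = ε * ((2 * C - 1) - 4 * C * Λ + 2 * C * ε) - (1 / 2 - (1 / 2 - C * ε) / 3) * g := by
  ring

end ElgindiAxisBalance
end Summit.NavierStokesRegularity.OSWSelfSimilar
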